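import Summits.CriticalPhenomena.PercolationContinuityZ3.Theorems.PercNearOneGluingNoHeavyRsw3VolumeMomentSums
import HarnessLib

/-!
# RSW3 lane (P2, gen 21): KESTEN'S THEOREM (8) IN ALL MOMENTS, IV-a — the lattice sum of nearest-neighbour weights over tuples
# `q : Fin t → Λ(n)`, by induction on `t`: `Σ_q W(S(q)) ≤ C_t · (n^d π_p(n))^t · π_p(n)` (every `p`, one-arm ratio inequalities)

builds on p205010 (kernel theorem, internal audit signed; external expert review pending) — NOT used in this file.

Cell `prim-rsw3`, prover seat `prim-rsw3-p2` (gen 21), memo `run/shared/lean/prim/rsw3/P2-RSWLITE.md` §28.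
Support file (`--supports stmt-CriticalPhenomena-4575`); no definitions, no named facts, no sorries.

Notation of the docstrings: `π(k) = π_p(k)`, `s(n) = n^d π(n)`, `δ⟦S,x⟧` the nearest-neighbour distance (written inline),
`W(S) = ∏_{x ∈ S} π(⌊(δ⟦S,x⟧−1)/2⌋)`, and for a tuple `q : Fin t → Λ(n)`, `S(q) = {0} ∪ range q`.  Hypotheses (R1), (R_lin), (R2),
`π(1) > 0`, `p > 0` as in part III.

* (tuple bookkeeping `S(cons a q) = S(q) ∪ {a}`, `Σ_{q : Fin (t+1) → Λ} = Σ_a Σ_{q : Fin t → Λ}` is in part II);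
* §2 `sum_prod_insert_le_unif` — ONE MORE POINT (uniform in `|S| ≤ t+2`, including `S = {0}`): `Σ_{a ∈ Λ(n)} W(S ∪ {a}) ≤ M_t s(n) W(S)`;
* §3 **`exists_sum_piFinset_weight_le`** — by induction on `t`: `Σ_{q : Fin (t+1) → Λ(n)} W(S(q)) ≤ C_t · s(n)^{t+1} · π(n)`;
* the probabilistic half (`P_p(⋂_i {0 ↔ q_i}) ≤ W(S(q))` by part I, and the `t`-point sums) is part IV-b (`…Rsw3VolumePointSums`).

References: H. Kesten, Probab. Theory Relat. Fields 73 (1986) 369–394, Thm. (8), (43)–(53), footnote 5 [Kesten1986];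
B. G. Nguyen, J. Stat. Phys. 50 (1988) (gap exponents); C. Borgs, J. Chayes, H. Kesten, J. Spencer, Random Structures Algorithms 15
(1999) [BorgsChayesKestenSpencer1999]. [folklore]
-/

noncomputable section

namespace Summit.CriticalPhenomena.PercolationContinuityZ3.Theorems

namespace Rsw3

open MeasureTheory Literature.Probability.LatticeModels Literature.Probability.Percolation
open SurfaceTension Crossing SimpleGraph Finset

variable {d : ℕ}

/-! ## §2 One more point, uniformly in the family (including the singleton `{0}`) -/

/-- **ONE MORE POINT, uniform form** (every `p > 0`, `d ≥ 1`, (R1), (R_lin), (R2), `π(1) > 0`): for `n ≥ 1` and `0 ∈ S ⊆ Λ(n)` with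
`|S| ≤ t + 2`, `Σ_{a ∈ Λ(n)} W(S ∪ {a}) ≤ M_t · n^d π(n) · W(S)` with
`M_t = (t+2)·(A'4^{d−1}/π(1) + (B/π(1))^{t+1} K) + (A16^{d−1}/π(1)² + C₂)` (part III: `|S| ≥ 2` by the insertion inequality,
`S = {0}` by the `π²` lattice sum and `π(n) ≤ 1`). [cite: Kesten1986, Thm. (8), (51)–(53)] -/
theorem sum_prod_insert_le_unif (hd : 1 ≤ d) (p : unitInterval) (hp : 0 < (p : ℝ)) {A A' B : ℝ} (hA : 0 ≤ A) (hA' : 0 ≤ A')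
    (hR1 : ∀ j n : ℕ, 1 ≤ j → j ≤ n →
      oneArmProb d p j ^ 2 * ((j : ℝ) / (16 * n)) ^ (d - 1) ≤ A * oneArmProb d p n ^ 2)
    (hRlin : ∀ j n : ℕ, 1 ≤ j → j ≤ n →
      oneArmProb d p j * ((j : ℝ) / (4 * n)) ^ (d - 1) ≤ A' * oneArmProb d p n)
    (hR2 : ∀ j n : ℕ, 1 ≤ j → j ≤ n → n ≤ 8 * j → oneArmProb d p j ≤ B * oneArmProb d p n)
    (hπ1 : 0 < oneArmProb d p 1) {n : ℕ} (hn : 1 ≤ n) {t : ℕ} {S : Finset (Site d)}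
    (h0 : (0 : Site d) ∈ S) (hSn : S ⊆ box d n) (hSt : S.card ≤ t + 2) :
    ∑ a ∈ box d n, ∏ x ∈ insert a S,
        oneArmProb d p ((((Finset.erase (insert a S) x).inf (fun w => ((Site.supNorm (x - w) : ℕ) : ℕ∞))).toNat - 1) / 2) ≤
      (((t : ℝ) + 2) * (A' * (4 : ℝ) ^ (d - 1) / oneArmProb d p 1 + (B / oneArmProb d p 1) ^ (t + 1) *
          ((2 : ℝ) ^ d * ((2 * d * A * (192 : ℝ) ^ (d - 1) + (5 : ℝ) ^ d * (A * (16 : ℝ) ^ (d - 1) / oneArmProb d p 1 ^ 2)) +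
            (2 * d * A' * (48 : ℝ) ^ (d - 1) + (5 : ℝ) ^ d * (A' * (4 : ℝ) ^ (d - 1) / oneArmProb d p 1))))) +
        (A * (16 : ℝ) ^ (d - 1) / oneArmProb d p 1 ^ 2 +
          (2 * d * A * (192 : ℝ) ^ (d - 1) + (5 : ℝ) ^ d * (A * (16 : ℝ) ^ (d - 1) / oneArmProb d p 1 ^ 2)))) *
        ((n : ℝ) ^ d * oneArmProb d p n) *
        ∏ x ∈ S, oneArmProb d p ((((Finset.erase S x).inf (fun w => ((Site.supNorm (x - w) : ℕ) : ℕ∞))).toNat - 1) / 2) := by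
  classical
  have hd0 : (0 : ℝ) < d := by exact_mod_cast (by omega : 0 < d)
  have hB1 : 1 ≤ B := by
    have h1 := hR2 1 1 le_rfl le_rfl (by norm_num)
    nlinarith
  have hπle1 : oneArmProb d p 1 ≤ 1 := measureReal_le_one
  have hπn : 0 ≤ oneArmProb d p n := measureReal_nonneg
  have hπn1 : oneArmProb d p n ≤ 1 := measureReal_le_one
  -- nonnegativity of the constants, on the explicit expressions (before `set`)
  have hK0 : 0 ≤ (2 : ℝ) ^ d * ((2 * d * A * (192 : ℝ) ^ (d - 1) + (5 : ℝ) ^ d * (A * (16 : ℝ) ^ (d - 1) / oneArmProb d p 1 ^ 2)) +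
      (2 * d * A' * (48 : ℝ) ^ (d - 1) + (5 : ℝ) ^ d * (A' * (4 : ℝ) ^ (d - 1) / oneArmProb d p 1))) := by positivity
  have hK₁0 : 0 ≤ A * (16 : ℝ) ^ (d - 1) / oneArmProb d p 1 ^ 2 +
      (2 * d * A * (192 : ℝ) ^ (d - 1) + (5 : ℝ) ^ d * (A * (16 : ℝ) ^ (d - 1) / oneArmProb d p 1 ^ 2)) := by positivity
  have hC₀0 : 0 ≤ A' * (4 : ℝ) ^ (d - 1) / oneArmProb d p 1 := by positivity
  have hD0 : 0 ≤ B / oneArmProb d p 1 := div_nonneg (by linarith) hπ1.le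
  have hD1 : 1 ≤ B / oneArmProb d p 1 := by rw [le_div_iff₀ hπ1]; nlinarith
  have hs0 : 0 ≤ (n : ℝ) ^ d * oneArmProb d p n := mul_nonneg (pow_nonneg (Nat.cast_nonneg n) d) hπn
  have h1s : 1 ≤ A' * (4 : ℝ) ^ (d - 1) / oneArmProb d p 1 * ((n : ℝ) ^ d * oneArmProb d p n) := by
    have := one_le_of_linRatio p hRlin hπ1 hn
    linarith [this]
  set K : ℝ := (2 : ℝ) ^ d * ((2 * d * A * (192 : ℝ) ^ (d - 1) + (5 : ℝ) ^ d * (A * (16 : ℝ) ^ (d - 1) / oneArmProb d p 1 ^ 2)) +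
    (2 * d * A' * (48 : ℝ) ^ (d - 1) + (5 : ℝ) ^ d * (A' * (4 : ℝ) ^ (d - 1) / oneArmProb d p 1))) with hK
  set D : ℝ := B / oneArmProb d p 1 with hDdef
  set C₀ : ℝ := A' * (4 : ℝ) ^ (d - 1) / oneArmProb d p 1 with hC₀
  set K₁ : ℝ := A * (16 : ℝ) ^ (d - 1) / oneArmProb d p 1 ^ 2 +
    (2 * d * A * (192 : ℝ) ^ (d - 1) + (5 : ℝ) ^ d * (A * (16 : ℝ) ^ (d - 1) / oneArmProb d p 1 ^ 2)) with hK₁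
  set s : ℝ := (n : ℝ) ^ d * oneArmProb d p n with hs
  have hW : 0 ≤ ∏ x ∈ S, oneArmProb d p ((((Finset.erase S x).inf (fun w => ((Site.supNorm (x - w) : ℕ) : ℕ∞))).toNat - 1) / 2) :=
    Finset.prod_nonneg fun x _ => measureReal_nonneg
  have ht0 : (0 : ℝ) ≤ (t : ℝ) + 2 := by positivity
  have hM0 : 0 ≤ ((t : ℝ) + 2) * (C₀ + D ^ (t + 1) * K) :=
    mul_nonneg ht0 (add_nonneg hC₀0 (mul_nonneg (pow_nonneg hD0 _) hK0))
  by_cases hS : 1 < S.card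
  · have h := sum_prod_insert_le_mul hd p hp hA hA' hR1 hRlin hR2 hπ1 hn hS hSn
    refine h.trans ?_
    rw [mul_comm]
    refine mul_le_mul_of_nonneg_right ?_ hW
    have hcard : (S.card : ℝ) ≤ t + 2 := by exact_mod_cast hSt
    have hDpow : D ^ (S.card - 1) ≤ D ^ (t + 1) := pow_le_pow_right₀ hD1 (by omega)
    have hcard0 : (0 : ℝ) ≤ S.card := by positivity
    have hKs : 0 ≤ K * (n : ℝ) ^ d * oneArmProb d p n := by rw [mul_assoc]; exact mul_nonneg hK0 hs0
    calc (S.card : ℝ) * (1 + D ^ (S.card - 1) * (K * (n : ℝ) ^ d * oneArmProb d p n))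
        ≤ ((t : ℝ) + 2) * (C₀ * s + D ^ (t + 1) * (K * (n : ℝ) ^ d * oneArmProb d p n)) := by
          refine mul_le_mul hcard (add_le_add h1s (mul_le_mul_of_nonneg_right hDpow hKs)) ?_ ht0
          exact add_nonneg zero_le_one (mul_nonneg (pow_nonneg hD0 _) hKs)
      _ = ((t : ℝ) + 2) * (C₀ + D ^ (t + 1) * K) * s := by rw [hs]; ring
      _ ≤ ((t : ℝ) + 2) * (C₀ + D ^ (t + 1) * K) * s + K₁ * s := le_add_of_nonneg_right (mul_nonneg hK₁0 hs0)
      _ = (((t : ℝ) + 2) * (C₀ + D ^ (t + 1) * K) + K₁) * s := by ring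
  · -- `S = {0}`
    have hS0 : S = {0} := by
      rw [Finset.eq_singleton_iff_unique_mem]
      refine ⟨h0, fun x hx => ?_⟩
      exact Finset.card_le_one.1 (not_lt.1 hS) x hx 0 h0
    subst hS0
    have h := sum_prod_insert_singleton_le hd p hA hR1 hπ1 hn
    refine h.trans ?_
    rw [Finset.prod_singleton, nnd_singleton, oneArmProb_zero hd p, mul_one]
    calc K₁ * (n : ℝ) ^ d * oneArmProb d p n ^ 2 = K₁ * s * oneArmProb d p n := by rw [hs]; ring
      _ ≤ K₁ * s * 1 := mul_le_mul_of_nonneg_left hπn1 (mul_nonneg hK₁0 hs0)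
      _ = K₁ * s := mul_one _
      _ ≤ ((t : ℝ) + 2) * (C₀ + D ^ (t + 1) * K) * s + K₁ * s := le_add_of_nonneg_left (mul_nonneg hM0 hs0)
      _ = (((t : ℝ) + 2) * (C₀ + D ^ (t + 1) * K) + K₁) * s := by ring

/-- **Peeling the first coordinate of the tuple**: `Σ_{q : Fin (t+1) → Λ(n)} W(S(q)) = Σ_{q' : Fin t → Λ(n)} Σ_{a ∈ Λ(n)} W(S(q') ∪ {a})`
(`S(cons a q') = S(q') ∪ {a}`). [folklore] -/
theorem sum_piFinset_weight_succ_eq (p : unitInterval) (n t : ℕ) :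
    ∑ q ∈ Fintype.piFinset (fun _ : Fin (t + 1) => box d n),
        ∏ x ∈ insert (0 : Site d) (Finset.univ.image q),
          oneArmProb d p ((((Finset.erase (insert (0 : Site d) (Finset.univ.image q)) x).inf
            (fun w => ((Site.supNorm (x - w) : ℕ) : ℕ∞))).toNat - 1) / 2) =
      ∑ q ∈ Fintype.piFinset (fun _ : Fin t => box d n), ∑ a ∈ box d n,
        ∏ x ∈ insert a (insert (0 : Site d) (Finset.univ.image q)),
          oneArmProb d p ((((Finset.erase (insert a (insert (0 : Site d) (Finset.univ.image q))) x).inf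
            (fun w => ((Site.supNorm (x - w) : ℕ) : ℕ∞))).toNat - 1) / 2) := by
  classical
  rw [sum_piFinset_succ_const, Finset.sum_comm]
  refine Finset.sum_congr rfl fun q _ => Finset.sum_congr rfl fun a _ => ?_
  rw [image_univ_cons, Finset.insert_comm]

/-! ## §3 The lattice sum over tuples, by induction on the number of points -/

/-- **THE LATTICE SUM OF NEAREST-NEIGHBOUR WEIGHTS** (every `p > 0`, `d ≥ 1`, (R1), (R_lin), (R2), `π(1) > 0`): for every `t` there is
`C_t > 0` with, for all `n ≥ 1`,
`Σ_{q : Fin (t+1) → Λ(n)} W(S(q)) ≤ C_t · (n^d π(n))^{t+1} · π(n)`,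
`S(q) = {0} ∪ range q`, `W(S) = ∏_{x ∈ S} π(⌊(δ⟦S,x⟧−1)/2⌋)` — induction on `t`: the case `t = 0` is `Σ_a W({0,a}) ≤ K₁ n^d π(n)²`, and
`Σ_{q : Fin (t+2) → Λ} W(S(q)) = Σ_{q'} Σ_a W(S(q') ∪ {a}) ≤ M_t s(n) Σ_{q'} W(S(q'))` (§2). [cite: Kesten1986, Thm. (8), (46)–(47), (52)] -/
theorem exists_sum_piFinset_weight_le (hd : 1 ≤ d) (p : unitInterval) (hp : 0 < (p : ℝ)) {A A' B : ℝ} (hA : 0 ≤ A)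
    (hA' : 0 ≤ A')
    (hR1 : ∀ j n : ℕ, 1 ≤ j → j ≤ n →
      oneArmProb d p j ^ 2 * ((j : ℝ) / (16 * n)) ^ (d - 1) ≤ A * oneArmProb d p n ^ 2)
    (hRlin : ∀ j n : ℕ, 1 ≤ j → j ≤ n →
      oneArmProb d p j * ((j : ℝ) / (4 * n)) ^ (d - 1) ≤ A' * oneArmProb d p n)
    (hR2 : ∀ j n : ℕ, 1 ≤ j → j ≤ n → n ≤ 8 * j → oneArmProb d p j ≤ B * oneArmProb d p n)
    (hπ1 : 0 < oneArmProb d p 1) (t : ℕ) :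
    ∃ C : ℝ, 0 < C ∧ ∀ n : ℕ, 1 ≤ n →
      ∑ q ∈ Fintype.piFinset (fun _ : Fin (t + 1) => box d n),
          ∏ x ∈ insert (0 : Site d) (Finset.univ.image q),
            oneArmProb d p ((((Finset.erase (insert (0 : Site d) (Finset.univ.image q)) x).inf
              (fun w => ((Site.supNorm (x - w) : ℕ) : ℕ∞))).toNat - 1) / 2) ≤
        C * (((n : ℝ) ^ d * oneArmProb d p n) ^ (t + 1) * oneArmProb d p n) := by
  classical
  have hd0 : (0 : ℝ) < d := by exact_mod_cast (by omega : 0 < d)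
  -- the constant of the base case
  have hK₁0 : 0 ≤ A * (16 : ℝ) ^ (d - 1) / oneArmProb d p 1 ^ 2 +
      (2 * d * A * (192 : ℝ) ^ (d - 1) + (5 : ℝ) ^ d * (A * (16 : ℝ) ^ (d - 1) / oneArmProb d p 1 ^ 2)) := by positivity
  induction t with
  | zero =>
    refine ⟨A * (16 : ℝ) ^ (d - 1) / oneArmProb d p 1 ^ 2 +
      (2 * d * A * (192 : ℝ) ^ (d - 1) + (5 : ℝ) ^ d * (A * (16 : ℝ) ^ (d - 1) / oneArmProb d p 1 ^ 2)) + 1,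
      by linarith, fun n hn => ?_⟩
    rw [sum_piFinset_weight_succ_eq]
    have hzero : ∀ q : Fin 0 → Site d, (∑ a ∈ box d n,
        ∏ x ∈ insert a (insert (0 : Site d) (Finset.univ.image q)),
          oneArmProb d p ((((Finset.erase (insert a (insert (0 : Site d) (Finset.univ.image q))) x).inf
            (fun w => ((Site.supNorm (x - w) : ℕ) : ℕ∞))).toNat - 1) / 2)) =
        ∑ a ∈ box d n, ∏ x ∈ insert a ({0} : Finset (Site d)),
          oneArmProb d p ((((Finset.erase (insert a {0}) x).inf (fun w => ((Site.supNorm (x - w) : ℕ) : ℕ∞))).toNat - 1) / 2) := by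
      intro q
      simp only [Finset.univ_eq_empty, Finset.image_empty, insert_empty_eq]
    rw [sum_piFinset_zero_const (box d n) _ _ hzero]
    refine (sum_prod_insert_singleton_le hd p hA hR1 hπ1 hn).trans ?_
    have hπn : 0 ≤ oneArmProb d p n := measureReal_nonneg
    have hs0 : 0 ≤ (n : ℝ) ^ d * oneArmProb d p n := mul_nonneg (pow_nonneg (Nat.cast_nonneg n) d) hπn
    have hx : 0 ≤ ((n : ℝ) ^ d * oneArmProb d p n) ^ (0 + 1) * oneArmProb d p n := mul_nonneg (pow_nonneg hs0 _) hπn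
    calc (A * (16 : ℝ) ^ (d - 1) / oneArmProb d p 1 ^ 2 +
          (2 * d * A * (192 : ℝ) ^ (d - 1) + (5 : ℝ) ^ d * (A * (16 : ℝ) ^ (d - 1) / oneArmProb d p 1 ^ 2))) *
          (n : ℝ) ^ d * oneArmProb d p n ^ 2
        = (A * (16 : ℝ) ^ (d - 1) / oneArmProb d p 1 ^ 2 +
          (2 * d * A * (192 : ℝ) ^ (d - 1) + (5 : ℝ) ^ d * (A * (16 : ℝ) ^ (d - 1) / oneArmProb d p 1 ^ 2))) *
          (((n : ℝ) ^ d * oneArmProb d p n) ^ (0 + 1) * oneArmProb d p n) := by ring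
      _ ≤ _ := mul_le_mul_of_nonneg_right (by linarith) hx
  | succ t ih =>
    obtain ⟨C, hC, hCle⟩ := ih
    -- the step constant `M_t` of §2
    set M : ℝ := ((t : ℝ) + 2) * (A' * (4 : ℝ) ^ (d - 1) / oneArmProb d p 1 + (B / oneArmProb d p 1) ^ (t + 1) *
          ((2 : ℝ) ^ d * ((2 * d * A * (192 : ℝ) ^ (d - 1) + (5 : ℝ) ^ d * (A * (16 : ℝ) ^ (d - 1) / oneArmProb d p 1 ^ 2)) +
            (2 * d * A' * (48 : ℝ) ^ (d - 1) + (5 : ℝ) ^ d * (A' * (4 : ℝ) ^ (d - 1) / oneArmProb d p 1))))) +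
        (A * (16 : ℝ) ^ (d - 1) / oneArmProb d p 1 ^ 2 +
          (2 * d * A * (192 : ℝ) ^ (d - 1) + (5 : ℝ) ^ d * (A * (16 : ℝ) ^ (d - 1) / oneArmProb d p 1 ^ 2))) with hM
    have hB1 : 1 ≤ B := by
      have h1 := hR2 1 1 le_rfl le_rfl (by norm_num)
      nlinarith
    have hM0 : 0 ≤ M := by
      have hB0 : 0 ≤ B := by linarith
      have h1 : 0 ≤ ((t : ℝ) + 2) * (A' * (4 : ℝ) ^ (d - 1) / oneArmProb d p 1 + (B / oneArmProb d p 1) ^ (t + 1) *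
          ((2 : ℝ) ^ d * ((2 * d * A * (192 : ℝ) ^ (d - 1) + (5 : ℝ) ^ d * (A * (16 : ℝ) ^ (d - 1) / oneArmProb d p 1 ^ 2)) +
            (2 * d * A' * (48 : ℝ) ^ (d - 1) + (5 : ℝ) ^ d * (A' * (4 : ℝ) ^ (d - 1) / oneArmProb d p 1))))) := by
        positivity
      rw [hM]; exact add_nonneg h1 hK₁0
    refine ⟨(M + 1) * C, mul_pos (by linarith) hC, fun n hn => ?_⟩
    have hs0 : 0 ≤ (n : ℝ) ^ d * oneArmProb d p n := mul_nonneg (pow_nonneg (Nat.cast_nonneg n) d) measureReal_nonneg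
    rw [sum_piFinset_weight_succ_eq]
    calc ∑ q ∈ Fintype.piFinset (fun _ : Fin (t + 1) => box d n), ∑ a ∈ box d n,
          ∏ x ∈ insert a (insert (0 : Site d) (Finset.univ.image q)),
            oneArmProb d p ((((Finset.erase (insert a (insert (0 : Site d) (Finset.univ.image q))) x).inf
              (fun w => ((Site.supNorm (x - w) : ℕ) : ℕ∞))).toNat - 1) / 2)
        ≤ ∑ q ∈ Fintype.piFinset (fun _ : Fin (t + 1) => box d n),
            M * ((n : ℝ) ^ d * oneArmProb d p n) * ∏ x ∈ insert (0 : Site d) (Finset.univ.image q),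
              oneArmProb d p ((((Finset.erase (insert (0 : Site d) (Finset.univ.image q)) x).inf
                (fun w => ((Site.supNorm (x - w) : ℕ) : ℕ∞))).toNat - 1) / 2) :=
          Finset.sum_le_sum fun q hq => sum_prod_insert_le_unif hd p hp hA hA' hR1 hRlin hR2 hπ1 hn
            (Finset.mem_insert_self _ _) (insert_image_subset_box hq) (by have := card_insert_image_le q; omega)
      _ = M * ((n : ℝ) ^ d * oneArmProb d p n) * ∑ q ∈ Fintype.piFinset (fun _ : Fin (t + 1) => box d n),
            ∏ x ∈ insert (0 : Site d) (Finset.univ.image q),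
              oneArmProb d p ((((Finset.erase (insert (0 : Site d) (Finset.univ.image q)) x).inf
                (fun w => ((Site.supNorm (x - w) : ℕ) : ℕ∞))).toNat - 1) / 2) := by rw [Finset.mul_sum]
      _ ≤ M * ((n : ℝ) ^ d * oneArmProb d p n) * (C * (((n : ℝ) ^ d * oneArmProb d p n) ^ (t + 1) * oneArmProb d p n)) :=
          mul_le_mul_of_nonneg_left (hCle n hn) (mul_nonneg hM0 hs0)
      _ = M * C * (((n : ℝ) ^ d * oneArmProb d p n) ^ (t + 1 + 1) * oneArmProb d p n) := by ring
      _ ≤ (M + 1) * C * (((n : ℝ) ^ d * oneArmProb d p n) ^ (t + 1 + 1) * oneArmProb d p n) := by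
          have hY : 0 ≤ ((n : ℝ) ^ d * oneArmProb d p n) ^ (t + 1 + 1) * oneArmProb d p n :=
            mul_nonneg (pow_nonneg hs0 _) measureReal_nonneg
          exact mul_le_mul_of_nonneg_right (by nlinarith) hY

end Rsw3

end Summit.CriticalPhenomena.PercolationContinuityZ3.Theorems
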